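import Mathlib.Analysis.InnerProductSpace.Basic
import Literature.MathematicalPhysics.QuantumFieldTheory.Balaban1983to89.B4Eq19LatticePoincareMorrey
import HarnessLib

/-!
# Line «poincare_lipschitz» on crux `HistoryTailL` (stmt-QuantumFields-19936), K2 organ of record LOC-REG-MIN — E→R ROAD, BRICK F6 «E→R»: THE DOOR
# ‹ONE-STEP ENERGY IMPROVEMENT ⟹ SMALL RANGE› — geometric energy decay under a downward-propagating threshold, the Morrey envelope, and the two-centre
# oscillation bound `‖u x′ − u a‖ ≤ C·√φ` for sphere∕vector-valued lattice maps

Cell `ym3-torus` (YM ladder rung R3 = continuum SU(2) Yang–Mills on the three-torus — a RUNG, NOT the Clay problem: not d = 4, not infinite volume, not a mass gap);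
width seat `ym3-torus-px8` gen 5 (★w5-19936 g12's LOCATE `E2R-ROAD-w5g12.md` §2–§3: brick F6 «E→R (M: iteration + Morrey ⇒ `osc ≤ C√φ`, handing `ω` to px7's
small-range files)»; LEAD ym-ust-19936-w1 g8).  THEOREMS ONLY (def-free); `--supports stmt-QuantumFields-19936 --as helper`.  This file is the CONSUMER-SIDE DOOR of
the road: its hypothesis is the one-step energy improvement that brick F5 is to print; NOTHING of F5, E→R, LOC-REG-MIN, `hReg`, a stub, `BlockLipschitzL`,
`HistoryTailL` or a summit statement is proved here.

LETTERS (px7 g5 ∕ ★w5 g12): `u : ℤ^d → V` (`V` ANY real inner-product space — no finite-dimensionality: one component `⟪u ·, v⟫` along the unit vector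
`v = (u x′ − u a)∕‖u x′ − u a‖` suffices), lit ✓`B4Eq19LatticeOperators.box`∕`unitVec`∕`gradSq`, the ENERGY `E x ρ = Σ_{y ∈ Q_ρ(x)} Σ_μ ‖u(y+e_μ) − u y‖²` (bound to a
letter `E : ℤ^d → ℤ → ℝ` by the hypothesis `hE`, so the statements stay short and the consumer instantiates `E := fun x ρ => …`, `hE := fun _ _ => rfl`), radii along
the INTEGER geometric ladder `m^k` (`k ≤ K`; no floors), a THRESHOLD `T : ℤ → ℝ` (for the road: `T r = ε₀·r∕(1 + log r)⁶`-type, see `threshold_of_antitone`).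

* §1 ★ `geometric_decay_threshold` — ABSTRACT DOWNWARD ITERATION WITH A THRESHOLD (real sequences): `E (k+1) ≤ T (k+1) → E k ≤ θ·E (k+1)` (`k < K`),
  `θ·T (k+1) ≤ T k`, `E K ≤ T K` ⟹ `E k ≤ θ^{K−k}·E K` AND `E k ≤ T k` for every `k ≤ K` (the threshold PROPAGATES DOWNWARD, so the conditional step fires at
  every scale).  ★ `morrey_envelope_of_geometric` — for a monotone `F : ℤ → ℝ` with `F(m^k) ≤ (m^p)^{−(K−k)}·F(m^K)` (`k ≤ K`, `m ≥ 2`):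
  `F ρ ≤ (m^p·F(m^K)∕(m^K)^p)·(ρ+1)^p` for all `0 ≤ ρ ≤ m^K` (fill-in between ladder radii by monotonicity).
* §2 `gradSq_inner_le` (`gradSq ⟪u ·, v⟫ (Q) ≤ E(u; Q)` for `‖v‖ ≤ 1`), ★★ `norm_sub_le_of_morrey` — THE V-VALUED TWO-CENTRE MORREY BOUND: if
  `E x ρ ≤ N·(ρ+1)^{d−1}` for all `0 ≤ ρ ≤ R₀` at the two centres `a`, `x′ ∈ Q_{ρ₀}(a)` (`1 ≤ ρ₀`, `2ρ₀ ≤ R₀`), then `‖u x′ − u a‖ ≤ 17·√(16d8^d)·√(N(2ρ₀+1))`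
  (lit ✓`B4Eq19LatticePoincareMorrey.abs_sub_le_of_morrey` on the component along `u x′ − u a`).
* §3 `geometricStep_of_oneStep` — BRIDGE from the one-step improvement AS F5 WILL PRINT IT, `E x r ≤ T r → E x ρ ≤ (A·((ρ+1)∕r)^d + ε)·E x r`
  (`1 ≤ ρ`, `ρ+1 ≤ r ≤ m^K`; harmonic exponent `d` as in px7's ✓`vec_harmonic_decay`), to the ladder step with `θ = (m^{d−1})⁻¹` once `2^{d+1}·A ≤ m` and
  `ε ≤ ½·(m^{d−1})⁻¹` (WHY `p = d − 1`: it is < the harmonic exponent `d` AND it is exactly the Morrey class `N(ρ+1)^{d−1}` that ✓`abs_sub_le_of_morrey` consumes — an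
  exponent below `d − 1` would not reach `osc ≤ C√φ` through that lemma); `threshold_of_antitone` — `T r = ε₀·r·g r` with `g ≥ 0` antitone on `[1,∞)` satisfies
  the propagation hypothesis `(m^{d−1})⁻¹·T(m^{k+1}) ≤ T(m^k)` when `d ≥ 2` (the road's `g r = (1 + log r)^{−6}`).
* §4 ★★ `morrey_at_centre_of_geometricStep` (one centre: ladder step + threshold + top-scale smallness ⟹ `E x ρ ≤ N(ρ+1)^{d−1}`, `N = m^{d−1}E x (m^K)∕(m^K)^{d−1}`),
  ★★★ `norm_sub_le_of_geometricStep` — THE DOOR: ladder step + threshold at every centre of `Q_{ρ₀}(a)`, `E x (m^K) ≤ Etop ≤ T(m^K)` there, `2ρ₀ ≤ m^K` ⟹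
  `‖u x′ − u a‖ ≤ 17·√(16d8^d)·√(m^{d−1}·Etop∕(m^K)^{d−1}·(2ρ₀+1))` for every `x′ ∈ Q_{ρ₀}(a)`; ★★★ `norm_sub_le_of_oneStep` — the same straight from F5's
  one-step shape via §3; `norm_sub_le_of_oneStep_three` — `d = 3`: `‖u x′ − u a‖ ≤ 17·√24576·m·√(3·Etop∕m^K)` = `C·√φ` with `φ = Etop∕m^K` the normalised
  energy at the top scale — px7's small-range hypothesis `ω`.
[folklore] (Campanato∕Morrey iteration with a multiplicative error: [Giaquinta1984] Ch. III Lemma 2.1 p.86, Thm 1.2 p.70; the small-energy regularity scheme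
[SchoenUhlenbeck1982] §4; the lattice statements are this file's).
-/

set_option autoImplicit false

noncomputable section

open scoped BigOperators InnerProductSpace
open Finset

namespace Summit.QuantumFields.YangMills.Theorems.PoincareLipschitzSmallRangeOfOneStep

open Literature.MathematicalPhysics.QuantumFieldTheory.Balaban1983to89
open B4Eq19LatticeOperators
open B4Eq19LatticePoincareMorrey (abs_sub_le_of_morrey)

variable {d : ℕ} {V : Type*} [NormedAddCommGroup V] [InnerProductSpace ℝ V]

/-! ## §1 Downward iteration with a threshold; the Morrey envelope of a geometric decay -/

/-- ★ **DOWNWARD GEOMETRIC ITERATION WITH A PROPAGATING THRESHOLD.**  If the conditional step `E (k+1) ≤ T (k+1) → E k ≤ θ·E (k+1)` holds for `k < K`, the threshold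
satisfies `θ·T (k+1) ≤ T k`, and the top scale is below threshold (`E K ≤ T K`), then EVERY scale is below threshold and `E k ≤ θ^{K−k}·E K` (`k ≤ K`).
[folklore] [cite: Giaquinta1984, Ch. III Lemma 2.1 p.86] -/
theorem geometric_decay_threshold (E T : ℕ → ℝ) {θ : ℝ} (hθ : 0 ≤ θ) (K : ℕ)
    (hstep : ∀ k, k < K → E (k + 1) ≤ T (k + 1) → E k ≤ θ * E (k + 1))
    (hT : ∀ k, k < K → θ * T (k + 1) ≤ T k) (htop : E K ≤ T K) :
    ∀ k, k ≤ K → E k ≤ θ ^ (K - k) * E K ∧ E k ≤ T k := by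
  -- induction on the depth `j = K − k`
  have main : ∀ j, j ≤ K → E (K - j) ≤ θ ^ j * E K ∧ E (K - j) ≤ T (K - j) := by
    intro j
    induction j with
    | zero => intro _; simp [htop]
    | succ j ih =>
      intro hj
      obtain ⟨ih1, ih2⟩ := ih (by omega)
      have hk : K - (j + 1) < K := by omega
      have hks : K - (j + 1) + 1 = K - j := by omega
      have h1 := hstep (K - (j + 1)) hk (by rw [hks]; exact ih2)
      have h2 := hT (K - (j + 1)) hk
      rw [hks] at h1 h2
      refine ⟨?_, ?_⟩
      · calc E (K - (j + 1)) ≤ θ * E (K - j) := h1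
          _ ≤ θ * (θ ^ j * E K) := mul_le_mul_of_nonneg_left ih1 hθ
          _ = θ ^ (j + 1) * E K := by ring
      · calc E (K - (j + 1)) ≤ θ * E (K - j) := h1
          _ ≤ θ * T (K - j) := mul_le_mul_of_nonneg_left ih2 hθ
          _ ≤ T (K - (j + 1)) := h2
  intro k hk
  have h := main (K - k) (Nat.sub_le _ _)
  rwa [Nat.sub_sub_self hk] at h

/-- ★ **THE MORREY ENVELOPE OF A GEOMETRIC DECAY ALONG `m^k`.**  `F : ℤ → ℝ` nonneg and monotone, `m ≥ 2`, and `F(m^k) ≤ ((m^p)⁻¹)^{K−k}·F(m^K)` for `k ≤ K`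
⟹ `F ρ ≤ (m^p·F(m^K)∕(m^K)^p)·(ρ+1)^p` for every `0 ≤ ρ ≤ m^K` (between two ladder radii use monotonicity; one factor `m^p` is the price). [folklore] -/
theorem morrey_envelope_of_geometric (F : ℤ → ℝ) (hF0 : ∀ ρ, 0 ≤ F ρ) (hmono : ∀ ρ ρ', ρ ≤ ρ' → F ρ ≤ F ρ') {m : ℕ} (hm : 2 ≤ m) (p K : ℕ)
    (hdec : ∀ k, k ≤ K → F ((m : ℤ) ^ k) ≤ (((m : ℝ) ^ p)⁻¹) ^ (K - k) * F ((m : ℤ) ^ K)) :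
    ∀ ρ : ℤ, 0 ≤ ρ → ρ ≤ (m : ℤ) ^ K → F ρ ≤ ((m : ℝ) ^ p * F ((m : ℤ) ^ K) / ((m : ℝ) ^ K) ^ p) * ((ρ : ℝ) + 1) ^ p := by
  classical
  intro ρ hρ0 hρK
  have hm0 : (0 : ℝ) < m := by exact_mod_cast (by omega : 0 < m)
  have hm1 : (1 : ℝ) ≤ m := by exact_mod_cast (by omega : 1 ≤ m)
  have hFt := hF0 ((m : ℤ) ^ K)
  have hρ0' : (0 : ℝ) ≤ ρ := by exact_mod_cast hρ0
  -- the least `k` with `ρ ≤ m^k`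
  have hex : ∃ k : ℕ, ρ ≤ (m : ℤ) ^ k := ⟨K, hρK⟩
  let k := Nat.find hex
  have hk : ρ ≤ (m : ℤ) ^ k := Nat.find_spec hex
  have hkK : k ≤ K := Nat.find_min' hex hρK
  -- `m^k ≤ m·(ρ+1)`
  have hlow : (m : ℝ) ^ k ≤ m * ((ρ : ℝ) + 1) := by
    by_cases hk0 : k = 0
    · rw [hk0, pow_zero]; nlinarith
    · obtain ⟨j, hj⟩ := Nat.exists_eq_succ_of_ne_zero hk0
      have hmin := Nat.find_min hex (show j < k by omega)
      push Not at hmin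
      have hj' : ((m : ℝ)) ^ j < ρ := by exact_mod_cast hmin
      rw [hj, pow_succ, mul_comm]
      exact mul_le_mul_of_nonneg_left (by linarith) hm0.le
  set a : ℝ := ((m : ℝ) ^ p) ^ (K - k) with ha
  set b : ℝ := ((m : ℝ) ^ k) ^ p with hb
  set c : ℝ := ((m : ℝ) ^ K) ^ p with hc
  have ha0 : 0 < a := by positivity
  have hb0 : 0 < b := by positivity
  have hc0 : 0 < c := by positivity
  have hab : a * b = c := by
    rw [ha, hb, hc, ← pow_mul, ← pow_mul, ← pow_mul, ← pow_add]
    congr 1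
    rw [mul_comm k p, ← Nat.mul_add, Nat.sub_add_cancel hkK, mul_comm]
  have hbX : b ≤ ((m : ℝ) * ((ρ : ℝ) + 1)) ^ p := pow_le_pow_left₀ (by positivity) hlow p
  have h1 : F ρ ≤ F ((m : ℤ) ^ k) := hmono _ _ hk
  have h2 : F ((m : ℤ) ^ k) ≤ a⁻¹ * F ((m : ℤ) ^ K) := by rw [ha, ← inv_pow]; exact hdec k hkK
  calc F ρ ≤ a⁻¹ * F ((m : ℤ) ^ K) := h1.trans h2
    _ = F ((m : ℤ) ^ K) * b / (a * b) := by field_simp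
    _ = F ((m : ℤ) ^ K) * b / c := by rw [hab]
    _ ≤ F ((m : ℤ) ^ K) * ((m : ℝ) * ((ρ : ℝ) + 1)) ^ p / c := by gcongr
    _ = ((m : ℝ) ^ p * F ((m : ℤ) ^ K) / ((m : ℝ) ^ K) ^ p) * ((ρ : ℝ) + 1) ^ p := by rw [hc, mul_pow]; ring

/-! ## §2 The `V`-valued two-centre Morrey bound -/

/-- A component of a vector map has no more lattice Dirichlet energy than the map: `gradSq ⟪u ·, v⟫ (Q) ≤ Σ_{y∈Q} Σ_μ ‖u(y+e_μ) − u y‖²` for `‖v‖ ≤ 1`. [folklore] -/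
theorem gradSq_inner_le (u : Zd d → V) {v : V} (hv : ‖v‖ ≤ 1) (Q : Finset (Zd d)) :
    gradSq (fun y => ⟪u y, v⟫_ℝ) Q ≤ ∑ y ∈ Q, ∑ μ, ‖u (y + unitVec μ) - u y‖ ^ 2 := by
  rw [gradSq_def]
  refine Finset.sum_le_sum fun y _ => Finset.sum_le_sum fun μ _ => ?_
  rw [fdiff_apply, ← inner_sub_left]
  have h1 : |⟪u (y + unitVec μ) - u y, v⟫_ℝ| ≤ ‖u (y + unitVec μ) - u y‖ * ‖v‖ := abs_real_inner_le_norm _ _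
  have h2 : ‖u (y + unitVec μ) - u y‖ * ‖v‖ ≤ ‖u (y + unitVec μ) - u y‖ := by
    have := mul_le_mul_of_nonneg_left hv (norm_nonneg (u (y + unitVec μ) - u y))
    rwa [mul_one] at this
  have h3 : |⟪u (y + unitVec μ) - u y, v⟫_ℝ| ≤ ‖u (y + unitVec μ) - u y‖ := h1.trans h2
  calc ⟪u (y + unitVec μ) - u y, v⟫_ℝ ^ 2 = |⟪u (y + unitVec μ) - u y, v⟫_ℝ| ^ 2 := (sq_abs _).symm
    _ ≤ ‖u (y + unitVec μ) - u y‖ ^ 2 := pow_le_pow_left₀ (abs_nonneg _) h3 2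

/-- ★★ **THE `V`-VALUED TWO-CENTRE MORREY BOUND.**  `d ≥ 1`, `x′ ∈ Q_{ρ₀}(a)`, `1 ≤ ρ₀`, `2ρ₀ ≤ R₀`; if the energy of `u` obeys the Morrey bound
`Σ_{Q_ρ} Σ_μ ‖u(y+e_μ) − u y‖² ≤ N·(ρ+1)^{d−1}` for all `0 ≤ ρ ≤ R₀` at BOTH centres `a` and `x′`, then `‖u x′ − u a‖ ≤ 17·√(16·d·8^d)·√(N·(2ρ₀+1))`
(lit ✓`abs_sub_le_of_morrey` applied to the component along `u x′ − u a`; `V` any real inner-product space). [folklore] [cite: Giaquinta1984, Ch. III Thm 1.2 p.70] -/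
theorem norm_sub_le_of_morrey (hd : 1 ≤ d) (u : Zd d → V) {a x' : Zd d} {ρ₀ : ℕ} (hρ₀ : 1 ≤ ρ₀) (hx' : x' ∈ box a (ρ₀ : ℤ))
    {N : ℝ} (hN : 0 ≤ N) {R₀ : ℤ} (hR₀ : 2 * (ρ₀ : ℤ) ≤ R₀)
    (hE_a : ∀ ρ : ℤ, 0 ≤ ρ → ρ ≤ R₀ → ∑ y ∈ box a ρ, ∑ μ, ‖u (y + unitVec μ) - u y‖ ^ 2 ≤ N * ((ρ : ℝ) + 1) ^ (d - 1))
    (hE_x : ∀ ρ : ℤ, 0 ≤ ρ → ρ ≤ R₀ → ∑ y ∈ box x' ρ, ∑ μ, ‖u (y + unitVec μ) - u y‖ ^ 2 ≤ N * ((ρ : ℝ) + 1) ^ (d - 1)) :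
    ‖u x' - u a‖ ≤ 17 * Real.sqrt (16 * d * 8 ^ d) * Real.sqrt (N * (2 * (ρ₀ : ℝ) + 1)) := by
  set w : V := u x' - u a with hw
  by_cases hw0 : w = 0
  · rw [hw0, norm_zero]; positivity
  · have hwn : 0 < ‖w‖ := norm_pos_iff.2 hw0
    set v : V := ‖w‖⁻¹ • w with hv
    have hv1 : ‖v‖ = 1 := by rw [hv, norm_smul, norm_inv, norm_norm, inv_mul_cancel₀ hwn.ne']
    have hfv : ⟪u x', v⟫_ℝ - ⟪u a, v⟫_ℝ = ‖w‖ := by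
      rw [← inner_sub_left, ← hw, hv, real_inner_smul_right, real_inner_self_eq_norm_sq]
      field_simp
    have h := abs_sub_le_of_morrey hd (fun y => ⟪u y, v⟫_ℝ) hρ₀ hx' hN hR₀
      (fun ρ hρ hρR => (gradSq_inner_le u hv1.le _).trans (hE_a ρ hρ hρR))
      (fun ρ hρ hρR => (gradSq_inner_le u hv1.le _).trans (hE_x ρ hρ hρR))
    rw [hfv, abs_of_pos hwn] at h
    exact h

/-! ## §3 From F5's one-step improvement to the ladder step; the threshold family -/

/-- **BRIDGE: ONE-STEP IMPROVEMENT ⟹ LADDER STEP.**  If (F5's shape) `E r ≤ T r → E ρ ≤ (A·((ρ+1)∕r)^d + ε)·E r` for `1 ≤ ρ`, `ρ + 1 ≤ r ≤ m^K`, with `E ≥ 0`,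
`A ≥ 0`, `m ≥ 2`, `2^{d+1}·A ≤ m` and `ε ≤ ½·(m^{d−1})⁻¹`, then along the ladder `E(m^{k+1}) ≤ T(m^{k+1}) → E(m^k) ≤ (m^{d−1})⁻¹·E(m^{k+1})` (`k < K`):
at `ρ = m^k`, `r = m^{k+1}` one has `A((ρ+1)∕r)^d ≤ A(2∕m)^d ≤ ½(m^{d−1})⁻¹`. [folklore] -/
theorem geometricStep_of_oneStep (hd : 1 ≤ d) (E T : ℤ → ℝ) (hE0 : ∀ ρ, 0 ≤ E ρ) {A ε : ℝ} (hA : 0 ≤ A) {m : ℕ} (hm : 2 ≤ m)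
    (hmA : (2 : ℝ) ^ (d + 1) * A ≤ m) (hε : ε ≤ 1 / 2 * ((m : ℝ) ^ (d - 1))⁻¹) (K : ℕ)
    (hone : ∀ ρ r : ℤ, 1 ≤ ρ → ρ + 1 ≤ r → r ≤ (m : ℤ) ^ K → E r ≤ T r → E ρ ≤ (A * (((ρ : ℝ) + 1) / r) ^ d + ε) * E r) :
    ∀ k, k < K → E ((m : ℤ) ^ (k + 1)) ≤ T ((m : ℤ) ^ (k + 1)) → E ((m : ℤ) ^ k) ≤ ((m : ℝ) ^ (d - 1))⁻¹ * E ((m : ℤ) ^ (k + 1)) := by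
  intro k hk hthr
  have hm0 : (0 : ℝ) < m := by exact_mod_cast (by omega : 0 < m)
  have hm2 : (2 : ℝ) ≤ m := by exact_mod_cast hm
  have hmz1 : (1 : ℤ) ≤ (m : ℤ) ^ k := one_le_pow₀ (by exact_mod_cast (by omega : 1 ≤ m))
  have hmz2 : (m : ℤ) ^ k + 1 ≤ (m : ℤ) ^ (k + 1) := by
    have h1 : (m : ℤ) ^ k * 2 ≤ (m : ℤ) ^ k * m := mul_le_mul_of_nonneg_left (by exact_mod_cast hm) (by positivity)
    rw [pow_succ]; linarith
  have hmz3 : (m : ℤ) ^ (k + 1) ≤ (m : ℤ) ^ K := pow_le_pow_right₀ (by exact_mod_cast (by omega : 1 ≤ m)) (by omega)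
  have h := hone ((m : ℤ) ^ k) ((m : ℤ) ^ (k + 1)) hmz1 hmz2 hmz3 hthr
  have hEr := hE0 ((m : ℤ) ^ (k + 1))
  -- the ratio: `((m^k + 1)/m^{k+1})^d ≤ (2/m)^d`
  have hratio : (((((m : ℤ) ^ k : ℤ) : ℝ) + 1) / (((m : ℤ) ^ (k + 1) : ℤ) : ℝ)) ^ d ≤ (2 / (m : ℝ)) ^ d := by
    push_cast
    refine pow_le_pow_left₀ (by positivity) ?_ d
    rw [div_le_div_iff₀ (by positivity) hm0, pow_succ]
    have : (1 : ℝ) ≤ (m : ℝ) ^ k := one_le_pow₀ (by linarith)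
    nlinarith
  -- `A (2/m)^d + ε ≤ (m^{d-1})⁻¹`
  have hkey : A * (2 / (m : ℝ)) ^ d + ε ≤ ((m : ℝ) ^ (d - 1))⁻¹ := by
    obtain ⟨d', rfl⟩ : ∃ d', d = d' + 1 := ⟨d - 1, by omega⟩
    simp only [add_tsub_cancel_right] at hε ⊢
    have hmd : (0 : ℝ) < (m : ℝ) ^ d' := pow_pos hm0 d'
    have e1 : A * (2 / (m : ℝ)) ^ (d' + 1) = (2 ^ (d' + 1) * A) / m * ((m : ℝ) ^ d')⁻¹ := by
      rw [div_pow, pow_succ (m : ℝ) d']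
      field_simp
    have e2 : (2 : ℝ) ^ (d' + 1) * A / m ≤ 1 / 2 := by
      rw [div_le_iff₀ hm0]
      have : (2 : ℝ) ^ (d' + 1 + 1) * A ≤ m := hmA
      rw [pow_succ] at this
      linarith
    rw [e1]
    have := mul_le_mul_of_nonneg_right e2 (inv_pos.2 hmd).le
    linarith
  calc E ((m : ℤ) ^ k) ≤ (A * (((((m : ℤ) ^ k : ℤ) : ℝ) + 1) / (((m : ℤ) ^ (k + 1) : ℤ) : ℝ)) ^ d + ε) * E ((m : ℤ) ^ (k + 1)) := h
    _ ≤ (A * (2 / (m : ℝ)) ^ d + ε) * E ((m : ℤ) ^ (k + 1)) := by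
        refine mul_le_mul_of_nonneg_right ?_ hEr
        have := mul_le_mul_of_nonneg_left hratio hA
        linarith
    _ ≤ ((m : ℝ) ^ (d - 1))⁻¹ * E ((m : ℤ) ^ (k + 1)) := mul_le_mul_of_nonneg_right hkey hEr

/-- **THE ROAD'S THRESHOLD FAMILY PROPAGATES.**  For `d ≥ 2`, `m ≥ 1`, `ε₀ ≥ 0` and `g ≥ 0` antitone on `[1, ∞)` (the road: `g r = (1 + log r)^{−6}`), the threshold
`T r := ε₀·r·g r` satisfies `(m^{d−1})⁻¹·T(m^{k+1}) ≤ T(m^k)`. [folklore] -/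
theorem threshold_of_antitone (hd : 2 ≤ d) {m : ℕ} (hm : 1 ≤ m) {ε₀ : ℝ} (hε₀ : 0 ≤ ε₀) (g : ℝ → ℝ) (hg0 : ∀ r, 1 ≤ r → 0 ≤ g r)
    (hg : ∀ r s, 1 ≤ r → r ≤ s → g s ≤ g r) (T : ℤ → ℝ) (hT : ∀ r : ℤ, T r = ε₀ * r * g r) (k : ℕ) :
    ((m : ℝ) ^ (d - 1))⁻¹ * T ((m : ℤ) ^ (k + 1)) ≤ T ((m : ℤ) ^ k) := by
  have hm0 : (0 : ℝ) < m := by exact_mod_cast (by omega : 0 < m)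
  have hm1 : (1 : ℝ) ≤ m := by exact_mod_cast hm
  have hmk1 : (1 : ℝ) ≤ (m : ℝ) ^ k := one_le_pow₀ hm1
  have hmk : (m : ℝ) ^ k ≤ (m : ℝ) ^ (k + 1) := pow_le_pow_right₀ hm1 (by omega)
  rw [hT, hT]
  push_cast
  have hgk := hg ((m : ℝ) ^ k) ((m : ℝ) ^ (k + 1)) hmk1 hmk
  have hgk0 := hg0 ((m : ℝ) ^ (k + 1)) (hmk1.trans hmk)
  -- `(m^{d-1})⁻¹ · m^{k+1} ≤ m^k` since `m ≤ m^{d-1}`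
  have hpow : ((m : ℝ) ^ (d - 1))⁻¹ * (m : ℝ) ^ (k + 1) ≤ (m : ℝ) ^ k := by
    have hmd : (m : ℝ) ≤ (m : ℝ) ^ (d - 1) := by
      calc (m : ℝ) = (m : ℝ) ^ 1 := (pow_one _).symm
        _ ≤ (m : ℝ) ^ (d - 1) := pow_le_pow_right₀ hm1 (by omega)
    have hmd0 : (0 : ℝ) < (m : ℝ) ^ (d - 1) := pow_pos hm0 _
    rw [inv_mul_le_iff₀ hmd0, pow_succ]
    calc (m : ℝ) ^ k * m ≤ (m : ℝ) ^ k * (m : ℝ) ^ (d - 1) := mul_le_mul_of_nonneg_left hmd (by positivity)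
      _ = (m : ℝ) ^ (d - 1) * (m : ℝ) ^ k := mul_comm _ _
  calc ((m : ℝ) ^ (d - 1))⁻¹ * (ε₀ * (m : ℝ) ^ (k + 1) * g ((m : ℝ) ^ (k + 1)))
      = ε₀ * (((m : ℝ) ^ (d - 1))⁻¹ * (m : ℝ) ^ (k + 1)) * g ((m : ℝ) ^ (k + 1)) := by ring
    _ ≤ ε₀ * (m : ℝ) ^ k * g ((m : ℝ) ^ (k + 1)) := by
        refine mul_le_mul_of_nonneg_right (mul_le_mul_of_nonneg_left hpow hε₀) hgk0
    _ ≤ ε₀ * (m : ℝ) ^ k * g ((m : ℝ) ^ k) := mul_le_mul_of_nonneg_left hgk (by positivity)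

/-! ## §4 The door -/

/-- ★★ **MORREY AT ONE CENTRE FROM THE LADDER STEP.**  `E x · ≥ 0` monotone in the radius (automatic for the energy letter), ladder step with threshold at the centre `x`
for `k < K`, threshold propagation, and top-scale smallness `E x (m^K) ≤ T(m^K)` ⟹ the Morrey bound `E x ρ ≤ (m^{d−1}·E x (m^K)∕(m^K)^{d−1})·(ρ+1)^{d−1}` for
all `0 ≤ ρ ≤ m^K`. [folklore] [cite: Giaquinta1984, Ch. III Lemma 2.1 p.86] -/
theorem morrey_at_centre_of_geometricStep (E : Zd d → ℤ → ℝ) (x : Zd d) (hE0 : ∀ ρ, 0 ≤ E x ρ) (hmono : ∀ ρ ρ', ρ ≤ ρ' → E x ρ ≤ E x ρ')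
    (T : ℤ → ℝ) {m : ℕ} (hm : 2 ≤ m) (K : ℕ)
    (hT : ∀ k, k < K → ((m : ℝ) ^ (d - 1))⁻¹ * T ((m : ℤ) ^ (k + 1)) ≤ T ((m : ℤ) ^ k))
    (hstep : ∀ k, k < K → E x ((m : ℤ) ^ (k + 1)) ≤ T ((m : ℤ) ^ (k + 1)) → E x ((m : ℤ) ^ k) ≤ ((m : ℝ) ^ (d - 1))⁻¹ * E x ((m : ℤ) ^ (k + 1)))
    (htop : E x ((m : ℤ) ^ K) ≤ T ((m : ℤ) ^ K)) :
    ∀ ρ : ℤ, 0 ≤ ρ → ρ ≤ (m : ℤ) ^ K →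
      E x ρ ≤ ((m : ℝ) ^ (d - 1) * E x ((m : ℤ) ^ K) / ((m : ℝ) ^ K) ^ (d - 1)) * ((ρ : ℝ) + 1) ^ (d - 1) := by
  have hm0 : (0 : ℝ) < m := by exact_mod_cast (by omega : 0 < m)
  have hθ : (0 : ℝ) ≤ ((m : ℝ) ^ (d - 1))⁻¹ := by positivity
  have hdec := geometric_decay_threshold (fun k => E x ((m : ℤ) ^ k)) (fun k => T ((m : ℤ) ^ k)) hθ K hstep hT htop
  exact morrey_envelope_of_geometric (E x) hE0 hmono hm (d - 1) K fun k hk => (hdec k hk).1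

/-- ★★★ **THE DOOR ‹LADDER STEP ⟹ SMALL RANGE›.**  `d ≥ 1`, `u : ℤ^d → V`, energy letter `E`, `m ≥ 2`, `1 ≤ ρ₀`, `2ρ₀ ≤ m^K`; at every centre `x ∈ Q_{ρ₀}(a)`: the
ladder step with threshold for `k < K`, and the top scale bounded `E x (m^K) ≤ Etop` and below threshold `E x (m^K) ≤ T(m^K)`; threshold propagation `hT`.  THEN for
every `x′ ∈ Q_{ρ₀}(a)`: `‖u x′ − u a‖ ≤ 17·√(16·d·8^d)·√(m^{d−1}·Etop∕(m^K)^{d−1}·(2ρ₀+1))`. [folklore] [cite: Giaquinta1984, Ch. III Lemma 2.1 p.86, Thm 1.2 p.70] -/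
theorem norm_sub_le_of_geometricStep (hd : 1 ≤ d) (u : Zd d → V) (E : Zd d → ℤ → ℝ)
    (hE : ∀ x ρ, E x ρ = ∑ y ∈ box x ρ, ∑ μ, ‖u (y + unitVec μ) - u y‖ ^ 2)
    (T : ℤ → ℝ) {m : ℕ} (hm : 2 ≤ m) (K : ℕ) (a : Zd d) {ρ₀ : ℕ} (hρ₀ : 1 ≤ ρ₀) (h2ρ₀ : 2 * (ρ₀ : ℤ) ≤ (m : ℤ) ^ K)
    (hT : ∀ k, k < K → ((m : ℝ) ^ (d - 1))⁻¹ * T ((m : ℤ) ^ (k + 1)) ≤ T ((m : ℤ) ^ k))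
    (hstep : ∀ x ∈ box a (ρ₀ : ℤ), ∀ k, k < K → E x ((m : ℤ) ^ (k + 1)) ≤ T ((m : ℤ) ^ (k + 1)) →
      E x ((m : ℤ) ^ k) ≤ ((m : ℝ) ^ (d - 1))⁻¹ * E x ((m : ℤ) ^ (k + 1)))
    {Etop : ℝ} (htop : ∀ x ∈ box a (ρ₀ : ℤ), E x ((m : ℤ) ^ K) ≤ Etop) (hthr : ∀ x ∈ box a (ρ₀ : ℤ), E x ((m : ℤ) ^ K) ≤ T ((m : ℤ) ^ K)) :
    ∀ x' ∈ box a (ρ₀ : ℤ), ‖u x' - u a‖ ≤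
      17 * Real.sqrt (16 * d * 8 ^ d) * Real.sqrt (((m : ℝ) ^ (d - 1) * Etop / ((m : ℝ) ^ K) ^ (d - 1)) * (2 * (ρ₀ : ℝ) + 1)) := by
  intro x' hx'
  have hm0 : (0 : ℝ) < m := by exact_mod_cast (by omega : 0 < m)
  have hE0 : ∀ x ρ, 0 ≤ E x ρ := fun x ρ => by
    rw [hE]; exact Finset.sum_nonneg fun _ _ => Finset.sum_nonneg fun _ _ => sq_nonneg _
  have hmono : ∀ x (ρ ρ' : ℤ), ρ ≤ ρ' → E x ρ ≤ E x ρ' := fun x ρ ρ' h => by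
    rw [hE, hE]
    exact Finset.sum_le_sum_of_subset_of_nonneg (box_mono x h) fun _ _ _ => Finset.sum_nonneg fun _ _ => sq_nonneg _
  have ha : a ∈ box a (ρ₀ : ℤ) := self_mem_box a (by positivity)
  have hEtop0 : 0 ≤ Etop := (hE0 a _).trans (htop a ha)
  set N : ℝ := (m : ℝ) ^ (d - 1) * Etop / ((m : ℝ) ^ K) ^ (d - 1) with hN
  have hN0 : 0 ≤ N := by rw [hN]; positivity
  -- Morrey at the two centres, with the common constant `N`
  have hMor : ∀ x ∈ box a (ρ₀ : ℤ), ∀ ρ : ℤ, 0 ≤ ρ → ρ ≤ (m : ℤ) ^ K →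
      ∑ y ∈ box x ρ, ∑ μ, ‖u (y + unitVec μ) - u y‖ ^ 2 ≤ N * ((ρ : ℝ) + 1) ^ (d - 1) := by
    intro x hx ρ hρ hρK
    have h := morrey_at_centre_of_geometricStep E x (hE0 x) (hmono x) T hm K hT (hstep x hx) (hthr x hx) ρ hρ hρK
    rw [← hE]
    refine h.trans (mul_le_mul_of_nonneg_right ?_ (by positivity))
    rw [hN]
    gcongr
    exact htop x hx
  exact norm_sub_le_of_morrey hd u hρ₀ hx' hN0 h2ρ₀ (hMor a ha) (hMor x' hx')

/-- ★★★ **THE DOOR ‹ONE-STEP IMPROVEMENT ⟹ SMALL RANGE› (F5's shape in, px7's `ω` out).**  `d ≥ 1`, `u : ℤ^d → V`, energy letter `E`, constants `A ≥ 0`, `ε`,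
an integer ratio `m ≥ 2` with `2^{d+1}·A ≤ m` and `ε ≤ ½·(m^{d−1})⁻¹`, a threshold `T` with `(m^{d−1})⁻¹·T(m^{k+1}) ≤ T(m^k)` (`threshold_of_antitone`), `1 ≤ ρ₀`,
`2ρ₀ ≤ m^K`.  HYPOTHESIS (the one-step energy improvement, at every centre `x ∈ Q_{ρ₀}(a)` and all radii `1 ≤ ρ`, `ρ + 1 ≤ r ≤ m^K`):
`E x r ≤ T r → E x ρ ≤ (A·((ρ+1)∕r)^d + ε)·E x r`; top scale: `E x (m^K) ≤ Etop` and `E x (m^K) ≤ T(m^K)` for `x ∈ Q_{ρ₀}(a)`.  CONCLUSION: for every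
`x′ ∈ Q_{ρ₀}(a)`, `‖u x′ − u a‖ ≤ 17·√(16·d·8^d)·√(m^{d−1}·Etop∕(m^K)^{d−1}·(2ρ₀+1))`. [folklore] [cite: Giaquinta1984, Ch. III Lemma 2.1 p.86, Thm 1.2 p.70;
SchoenUhlenbeck1982, §4] -/
theorem norm_sub_le_of_oneStep (hd : 1 ≤ d) (u : Zd d → V) (E : Zd d → ℤ → ℝ)
    (hE : ∀ x ρ, E x ρ = ∑ y ∈ box x ρ, ∑ μ, ‖u (y + unitVec μ) - u y‖ ^ 2)
    (T : ℤ → ℝ) {A ε : ℝ} (hA : 0 ≤ A) {m : ℕ} (hm : 2 ≤ m) (hmA : (2 : ℝ) ^ (d + 1) * A ≤ m) (hε : ε ≤ 1 / 2 * ((m : ℝ) ^ (d - 1))⁻¹)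
    (K : ℕ) (a : Zd d) {ρ₀ : ℕ} (hρ₀ : 1 ≤ ρ₀) (h2ρ₀ : 2 * (ρ₀ : ℤ) ≤ (m : ℤ) ^ K)
    (hT : ∀ k, k < K → ((m : ℝ) ^ (d - 1))⁻¹ * T ((m : ℤ) ^ (k + 1)) ≤ T ((m : ℤ) ^ k))
    (hone : ∀ x ∈ box a (ρ₀ : ℤ), ∀ ρ r : ℤ, 1 ≤ ρ → ρ + 1 ≤ r → r ≤ (m : ℤ) ^ K → E x r ≤ T r →
      E x ρ ≤ (A * (((ρ : ℝ) + 1) / r) ^ d + ε) * E x r)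
    {Etop : ℝ} (htop : ∀ x ∈ box a (ρ₀ : ℤ), E x ((m : ℤ) ^ K) ≤ Etop) (hthr : ∀ x ∈ box a (ρ₀ : ℤ), E x ((m : ℤ) ^ K) ≤ T ((m : ℤ) ^ K)) :
    ∀ x' ∈ box a (ρ₀ : ℤ), ‖u x' - u a‖ ≤
      17 * Real.sqrt (16 * d * 8 ^ d) * Real.sqrt (((m : ℝ) ^ (d - 1) * Etop / ((m : ℝ) ^ K) ^ (d - 1)) * (2 * (ρ₀ : ℝ) + 1)) := by
  have hE0 : ∀ x ρ, 0 ≤ E x ρ := fun x ρ => by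
    rw [hE]; exact Finset.sum_nonneg fun _ _ => Finset.sum_nonneg fun _ _ => sq_nonneg _
  exact norm_sub_le_of_geometricStep hd u E hE T hm K a hρ₀ h2ρ₀ hT
    (fun x hx => geometricStep_of_oneStep hd (E x) T (hE0 x) hA hm hmA hε K (hone x hx)) htop hthr

/-- **`d = 3`: THE E→R CONSTANT SHAPE.**  In three dimensions (`16·A ≤ m`, `ε ≤ ½m⁻²`, threshold propagation with `m⁻²`) the door's bound reads, using
`2ρ₀ + 1 ≤ 3·m^K`: `‖u x′ − u a‖ ≤ 17·√24576·√(3·m²·Etop∕m^K)` for every `x′ ∈ Q_{ρ₀}(a)` — `C·m·√(Etop∕m^K) = C·√φ` with `φ` the normalised energy at the top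
scale `m^K`: px7's small-range hypothesis `ω`. [folklore] -/
theorem norm_sub_le_of_oneStep_three (u : Zd 3 → V) (E : Zd 3 → ℤ → ℝ)
    (hE : ∀ x ρ, E x ρ = ∑ y ∈ box x ρ, ∑ μ, ‖u (y + unitVec μ) - u y‖ ^ 2)
    (T : ℤ → ℝ) {A ε : ℝ} (hA : 0 ≤ A) {m : ℕ} (hm : 2 ≤ m) (hmA : 16 * A ≤ m) (hε : ε ≤ 1 / 2 * ((m : ℝ) ^ 2)⁻¹)
    (K : ℕ) (a : Zd 3) {ρ₀ : ℕ} (hρ₀ : 1 ≤ ρ₀) (h2ρ₀ : 2 * (ρ₀ : ℤ) ≤ (m : ℤ) ^ K)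
    (hT : ∀ k, k < K → ((m : ℝ) ^ 2)⁻¹ * T ((m : ℤ) ^ (k + 1)) ≤ T ((m : ℤ) ^ k))
    (hone : ∀ x ∈ box a (ρ₀ : ℤ), ∀ ρ r : ℤ, 1 ≤ ρ → ρ + 1 ≤ r → r ≤ (m : ℤ) ^ K → E x r ≤ T r →
      E x ρ ≤ (A * (((ρ : ℝ) + 1) / r) ^ 3 + ε) * E x r)
    {Etop : ℝ} (htop : ∀ x ∈ box a (ρ₀ : ℤ), E x ((m : ℤ) ^ K) ≤ Etop) (hthr : ∀ x ∈ box a (ρ₀ : ℤ), E x ((m : ℤ) ^ K) ≤ T ((m : ℤ) ^ K)) :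
    ∀ x' ∈ box a (ρ₀ : ℤ), ‖u x' - u a‖ ≤ 17 * Real.sqrt 24576 * Real.sqrt (3 * (m : ℝ) ^ 2 * Etop / (m : ℝ) ^ K) := by
  intro x' hx'
  have hm0 : (0 : ℝ) < m := by exact_mod_cast (by omega : 0 < m)
  have hmK : (0 : ℝ) < (m : ℝ) ^ K := pow_pos hm0 K
  have ha : a ∈ box a (ρ₀ : ℤ) := self_mem_box a (by positivity)
  have hEtop0 : 0 ≤ Etop := by
    have := htop a ha; rw [hE] at this
    exact (Finset.sum_nonneg fun _ _ => Finset.sum_nonneg fun _ _ => sq_nonneg _).trans this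
  have h := norm_sub_le_of_oneStep (d := 3) (by norm_num) u E hE T hA hm (by norm_num; linarith) (by simpa using hε) K a hρ₀ h2ρ₀
    (by simpa using hT) hone htop hthr x' hx'
  simp only [Nat.cast_ofNat] at h
  rw [show (16 : ℝ) * 3 * 8 ^ 3 = 24576 by norm_num, show (3 - 1 : ℕ) = 2 from rfl] at h
  refine h.trans (mul_le_mul_of_nonneg_left (Real.sqrt_le_sqrt ?_) (by positivity))
  -- `m²·Etop/(m^K)² · (2ρ₀+1) ≤ 3·m²·Etop/m^K` since `2ρ₀ + 1 ≤ 3·m^K`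
  have h2ρ₀' : 2 * (ρ₀ : ℝ) ≤ (m : ℝ) ^ K := by exact_mod_cast h2ρ₀
  have h1K : (1 : ℝ) ≤ (m : ℝ) ^ K := one_le_pow₀ (by exact_mod_cast (by omega : 1 ≤ m))
  have hρ3 : 2 * (ρ₀ : ℝ) + 1 ≤ 3 * (m : ℝ) ^ K := by linarith
  rw [show ((m : ℝ) ^ K) ^ 2 = (m : ℝ) ^ K * (m : ℝ) ^ K by ring]
  rw [div_mul_eq_mul_div, div_le_div_iff₀ (by positivity) hmK]
  have : (m : ℝ) ^ 2 * Etop * (2 * (ρ₀ : ℝ) + 1) ≤ (m : ℝ) ^ 2 * Etop * (3 * (m : ℝ) ^ K) :=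
    mul_le_mul_of_nonneg_left hρ3 (by positivity)
  nlinarith [this, hmK, hEtop0]

end Summit.QuantumFields.YangMills.Theorems.PoincareLipschitzSmallRangeOfOneStep

end
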